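import Summits.Ventures.HSemireg.WedgeHankelSecantSiegel
import Summits.Ventures.HSemireg.WedgeHankelSecantPointKernel

/-!
# Venture HSemireg — THE SIEGEL IDEAL THROUGH THE POINT: `SI_k = (⋂_{i<k} F_{λ_i}(k)) ∩ F_∞(k)` (`2k ≤ m`), and secants through the point
# with more than `k` nodes are generic in degree `k`

HONEST FRAMING. Part of the Lean index of the computation cell `pub-hsemireg` (seat p10 gen 14, Sunday typer «UNIFORM-IN-n»).
Finite-dimensional EXTERIOR ALGEBRA over a field and ranks of HANKEL MATRICES ONLY: no variety, no cohomology theory, no sheaf, no Ext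
group and no semiregularity map is constructed here; nothing here says that HC / HC_CM / HC_AV holds; no Literature fact is declared or
used.  Custodian versions cited: theory/FORMULA-N.md PART A §2.6 THEOREM H / FN-4 (i); STRUCTURE.md v1.0-SIGNED 9b196a05977dd067 §1.1 C15.
The dictionary (`Σ_i A_i exp(λ_i Θ) + c·pt` ↦ `q_j = Σ_i A_i λ_i^j + c·[j = m]` ↦ `w_m(q)`) is QUOTED, never asserted.

WHAT IS KEYED.  D3 (`WedgeHankelSecantSiegel`): `SI_k = ⋂_{i<r} F_{λ_i}(k)` for any `r ≥ k + 1` FINITE distinct slopes (`2k ≤ m`); D4/D5: the node at infinity in the rank law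
(`rank H_k = r + 1` for `r + 1 ≤ min(k+1, m+1−k)`) and in the kernel law (`Kr = (⋂_i F_{λ_i}(k)) ∩ F_∞(k)`).  THIS FILE lets the point be one of the `k + 1` nodes:
* §1 FULL RANK THROUGH THE POINT: `B'` (the projective weighted node matrix) is injective on `c' + 1 ≤ r + 1` columns (`mulVecLin_injective_p`), so
  **`rank_hankel1_psecSeq_of_le`: `rank H_k(Σ_{i<r} A_i λ_i^• + c·δ_m) = k + 1` for `k + 1 ≤ r + 1 ≤ m + 1 − k`** (any non-zero weights).
* §2 **`Kr_w_psecSeq_eq_siegelIdeal`**: in that range the degree-`k` kernel of a secant through the point is EXACTLY `SI_k`.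
* §3 **`iInf_frameIdeal_inf_Y_eq_siegelIdeal`: for `1 ≤ k`, `2k ≤ m` and ANY `r ≥ k` distinct finite slopes, `(⋂_{i<r} F_{λ_i}(k)) ∩ F_∞(k) = SI_k`** —
  `k` finite frames and the frame at infinity already cut out the Siegel ideal; **`mul_w_eq_zero_of_forall_uprod_of_point`**: a degree-`k` form killing `k`
  exponentials of distinct slopes AND the point kills every class.  (`k = 2`, `m ≥ 4`: two line-bundle-type classes and the point suffice.)
Namespace `Summit.Ventures.HSemireg.Wedge.HankelSecant` (continued); new names only.
-/

open Module
open scoped Matrix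

namespace Summit.Ventures.HSemireg.Wedge.HankelSecant

open Summit.Ventures.HSemireg.Wedge Summit.Ventures.HSemireg.Wedge.Kunneth Summit.Ventures.HSemireg.Wedge.KunnethKernel
  Summit.Ventures.HSemireg.Wedge.HankelFaces Summit.Ventures.HSemireg.Wedge.HankelBox Summit.Ventures.HSemireg.Wedge.HankelPureKernel
  Summit.Ventures.HSemireg.Wedge.HankelSiegelIdeal

variable (K : Type*) [Field K]

/-! ## §1. Full rank through the point -/

variable {K} in
/-- `B'` is injective on `c' + 1 ≤ r + 1` columns (non-zero weights, `c ≠ 0`, distinct finite nodes): the point row kills the last coefficient,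
D1's minor on the first `c'` nodes the others. -/
theorem mulVecLin_injective_p {r c' : ℕ} (hcr : c' ≤ r) {A lam : Fin r → K} (hA : ∀ i, A i ≠ 0) {c : K} (hc : c ≠ 0)
    (hlam : Function.Injective lam) : Function.Injective (pNodeMat A lam c (c' + 1)).mulVecLin := by
  rw [← LinearMap.ker_eq_bot, LinearMap.ker_eq_bot']
  intro w hw
  have hrow : ∀ j : Fin (r + 1), ∑ l : Fin (c' + 1), pNodeMat A lam c (c' + 1) j l * w l = 0 := fun j => by
    have h := congrFun hw j
    simpa [Matrix.mulVecLin_apply, Matrix.mulVec, dotProduct] using h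
  have hlast : w (Fin.last c') = 0 := by
    have h := hrow (Fin.last r)
    rw [Fin.sum_univ_castSucc] at h
    simp only [pNodeMat_last, Fin.val_castSucc, Fin.val_last, if_true] at h
    rw [Finset.sum_eq_zero (fun l _ => by rw [if_neg (by have := l.isLt; omega), zero_mul]), zero_add, mul_eq_zero] at h
    exact h.resolve_left hc
  have hfin : (fun l => w (Fin.castSucc l)) = 0 := by
    have hinj := mulVecLin_injective (K := K) hcr hA hlam
    rw [← LinearMap.ker_eq_bot, LinearMap.ker_eq_bot'] at hinj
    refine hinj _ ?_
    funext i
    have h := hrow (Fin.castSucc i)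
    rw [Fin.sum_univ_castSucc, hlast, mul_zero, add_zero] at h
    simp only [pNodeMat_castSucc, Fin.val_castSucc] at h
    simpa [Matrix.mulVecLin_apply, Matrix.mulVec, dotProduct, wNodeMat] using h
  funext l
  refine Fin.lastCases ?_ (fun i => ?_) l
  · exact hlast
  · exact congrFun hfin i

variable {K} in
/-- … so `B'` has rank `c' + 1` on `c' + 1 ≤ r + 1` columns. -/
theorem rank_pNodeMat_of_le {r c' : ℕ} (hcr : c' ≤ r) {A lam : Fin r → K} (hA : ∀ i, A i ≠ 0) {c : K} (hc : c ≠ 0)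
    (hlam : Function.Injective lam) : (pNodeMat A lam c (c' + 1)).rank = c' + 1 := by
  rw [Matrix.rank, LinearMap.finrank_range_of_inj (mulVecLin_injective_p hcr hA hc hlam), finrank_fintype_fun_eq_card, Fintype.card_fin]

variable {K} in
/-- **FULL RANK THROUGH THE POINT: `rank H_k(Σ_{i<r} A_i λ_i^• + c·δ_m) = k + 1` for `k + 1 ≤ r + 1 ≤ m + 1 − k`** (distinct finite nodes, any non-zero
weights, `c ≠ 0`; every field). -/
theorem rank_hankel1_psecSeq_of_le {m k r : ℕ} (hkr : k ≤ r) (hrm : r + 1 ≤ m + 1 - k) {A lam : Fin r → K} (hA : ∀ i, A i ≠ 0) {c : K}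
    (hc : c ≠ 0) (hlam : Function.Injective lam) : (Hankel.hankel1 K m k (psecSeq K m A lam c)).rank = k + 1 := by
  rw [hankel1_psecSeq (by omega), Matrix.rank, Matrix.mulVecLin_mul,
    LinearMap.range_comp_of_range_eq_top _ (range_pNodeMat_mulVecLin_eq_top hrm (fun _ => one_ne_zero) one_ne_zero hlam), ← Matrix.rank,
    Matrix.rank_transpose, rank_pNodeMat_of_le hkr hA hc hlam]

/-! ## §2. Secants through the point with more than `k` nodes are generic -/

section Kernel

variable (m : ℕ)

/-- `V(univ, f, a)` is the range of th-7's `θ ↦ θ ∧ f ∣ ⋀^a` (private copy; cf. C3's `V_univ_w`). -/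
private lemma V_univ_eq_range₃ (a : ℕ) (f : HT K (Hankel.In m)) :
    V K (Hankel.In m) Finset.univ f a = LinearMap.range (Hankel.wedge K m a f) := by
  rw [V_eq_map, Hom_univ_eq_exteriorPower, Hankel.wedge, LinearMap.range_comp, Submodule.range_subtype]

/-- rank–nullity against THEOREM H (private copy of C3's `finrank_Kr_w_add`). -/
private lemma finrank_Kr_w_add₃ (a : ℕ) (q : ℕ → K) :
    finrank K (Kr K Finset.univ (Hankel.w K m m q) a) + m.choose a * (Hankel.hankel1 K m a q).rank = (m + m).choose a := by
  have h := finrank_Kr_add_finrank_V K (Finset.univ : Finset (Hankel.In m)) (Hankel.w K m m q) a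
  rw [Finset.card_univ, Fintype.card_fin, V_univ_eq_range₃, Hankel.hankelLaw_model] at h
  exact h

/-- **`Kr(univ, w_m(Σ_{i<r} A_i λ_i^• + c·δ_m), k) = SI_k` for `k ≤ r`, `r + 1 ≤ m + 1 − k`** (distinct finite slopes, any non-zero weights, `c ≠ 0`): full rank
through the point (§1) + gen 11's count + D3's containment. -/
theorem Kr_w_psecSeq_eq_siegelIdeal {r k : ℕ} (hkr : k ≤ r) (hrm : r + 1 ≤ m + 1 - k) {A lam : Fin r → K} (hA : ∀ i, A i ≠ 0) {c : K}
    (hc : c ≠ 0) (hlam : Function.Injective lam) : Kr K Finset.univ (Hankel.w K m m (psecSeq K m A lam c)) k = siegelIdeal K m k := by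
  refine (Submodule.eq_of_le_of_finrank_eq (siegelIdeal_le_Kr_w K m k _) ?_).symm
  have h1 := finrank_Kr_w_add₃ K m k (psecSeq K m A lam c)
  rw [rank_hankel1_psecSeq_of_le hkr hrm hA hc hlam] at h1
  have h2 := finrank_siegelIdeal K (n := m) k
  have e : m.choose k * (k + 1) = (k + 1) * m.choose k := Nat.mul_comm _ _
  omega

/-- wedge form: `ker(θ ↦ θ ∧ w_m(Σ_i A_i λ_i^• + c·δ_m) ∣ ⋀^k) = SI_k` (comapped), same range. -/
theorem ker_wedge_w_psecSeq_eq_siegelIdeal {r k : ℕ} (hkr : k ≤ r) (hrm : r + 1 ≤ m + 1 - k) {A lam : Fin r → K} (hA : ∀ i, A i ≠ 0)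
    {c : K} (hc : c ≠ 0) (hlam : Function.Injective lam) :
    LinearMap.ker (wedge K (Hankel.In m) k (Hankel.w K m m (psecSeq K m A lam c))) = (siegelIdeal K m k).comap (⋀[K]^k (Hankel.In m → K)).subtype := by
  rw [ker_wedge_eq_comap_Kr, Kr_w_psecSeq_eq_siegelIdeal K m hkr hrm hA hc hlam]

/-! ## §3. The Siegel ideal from `k` finite frames and the frame at infinity -/

/-- **`(⋂_{i<k} F_{λ_i}(k)) ∩ F_∞(k) = SI_k`** for EXACTLY `k` distinct finite slopes, `1 ≤ k`, `2k ≤ m` (D5's projective kernel law at `r = k` is §2's generic kernel). -/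
theorem iInf_frameIdeal_inf_Y_eq_siegelIdeal_self {k : ℕ} (hk : 1 ≤ k) (hkm : k + k ≤ m) {lam : Fin k → K} (hlam : Function.Injective lam) :
    (⨅ i, frameIdeal K m (uvec K m (lam i)) k) ⊓ frameIdeal K m (Hankel.Y K m) k = siegelIdeal K m k := by
  rw [← Kr_w_psecSeq K m hk le_rfl (by omega) (A := fun _ => (1 : K)) (fun _ => one_ne_zero) (c := (1 : K)) one_ne_zero hlam]
  exact Kr_w_psecSeq_eq_siegelIdeal K m le_rfl (by omega) (fun _ => one_ne_zero) one_ne_zero hlam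

/-- **THE SIEGEL IDEAL THROUGH THE POINT: `(⋂_{i<r} F_{λ_i}(k)) ∩ F_∞(k) = SI_k` for ANY `r ≥ k` distinct finite slopes** (`1 ≤ k`, `2k ≤ m`; every field, `m`) —
`k` exponentials of distinct slopes and the point already cut the degree-`k` kernel down to the Siegel ideal. -/
theorem iInf_frameIdeal_inf_Y_eq_siegelIdeal {k : ℕ} (hk : 1 ≤ k) (hkm : k + k ≤ m) {r : ℕ} (hkr : k ≤ r) {lam : Fin r → K}
    (hlam : Function.Injective lam) : (⨅ i, frameIdeal K m (uvec K m (lam i)) k) ⊓ frameIdeal K m (Hankel.Y K m) k = siegelIdeal K m k := by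
  apply le_antisymm
  · rw [← iInf_frameIdeal_inf_Y_eq_siegelIdeal_self K m hk hkm (lam := lam ∘ Fin.castLE hkr) (hlam.comp (Fin.castLE_injective hkr))]
    exact inf_le_inf_right _ (le_iInf fun i => iInf_le _ (Fin.castLE hkr i))
  · exact le_inf (siegelIdeal_le_iInf_frameIdeal K m lam hk) (siegelIdeal_le_frameIdeal_Y K m (by omega) hk)

/-- dimension check: `dim((⋂_{i<r} F_{λ_i}(k)) ∩ F_∞(k)) + (k+1)·C(m,k) = C(2m,k)` for any `r ≥ k` distinct finite slopes (`1 ≤ k`, `2k ≤ m`). -/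
theorem finrank_iInf_frameIdeal_inf_Y_add_of_le {k : ℕ} (hk : 1 ≤ k) (hkm : k + k ≤ m) {r : ℕ} (hkr : k ≤ r) {lam : Fin r → K}
    (hlam : Function.Injective lam) :
    finrank K ↥((⨅ i, frameIdeal K m (uvec K m (lam i)) k) ⊓ frameIdeal K m (Hankel.Y K m) k) + (k + 1) * m.choose k = (m + m).choose k := by
  rw [iInf_frameIdeal_inf_Y_eq_siegelIdeal K m hk hkm hkr hlam]
  exact finrank_siegelIdeal K (n := m) k

/-- **KILLING `k` EXPONENTIALS AND THE POINT KILLS EVERYTHING**: a degree-`k` form (`1 ≤ k`, `2k ≤ m`) that kills the pure classes of `r ≥ k` distinct finite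
slopes and the point class `E_{y-block}` kills `w_m(q)` for EVERY coefficient sequence `q`. -/
theorem mul_w_eq_zero_of_forall_uprod_of_point {k : ℕ} (hk : 1 ≤ k) (hkm : k + k ≤ m) {r : ℕ} (hkr : k ≤ r) {lam : Fin r → K}
    (hlam : Function.Injective lam) {θ : HT K (Hankel.In m)} (hθ : θ ∈ Hom K (Hankel.In m) Finset.univ k)
    (h : ∀ i, θ * uprod K m (lam i) m = 0) (hpt : θ * B K (Hankel.In m) (WedgePair.Yset m) = 0) (q : ℕ → K) : θ * Hankel.w K m m q = 0 := by
  have hm : 1 ≤ m := by omega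
  have hmem : θ ∈ (⨅ i, frameIdeal K m (uvec K m (lam i)) k) ⊓ frameIdeal K m (Hankel.Y K m) k := by
    refine Submodule.mem_inf.mpr ⟨(Submodule.mem_iInf _).mpr fun i => ?_, ?_⟩
    · rw [← Kr_w_expSeq K m one_ne_zero (lam i) hk, mem_Kr, w_expSeq, one_smul]
      exact ⟨hθ, h i⟩
    · rw [← Kr_w_point K m hm one_ne_zero hk, mem_Kr, w_ppSeq_zero K m hm, one_smul]
      exact ⟨hθ, hpt⟩
  rw [iInf_frameIdeal_inf_Y_eq_siegelIdeal K m hk hkm hkr hlam] at hmem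
  exact mul_w_eq_zero_of_mem_siegelIdeal K hmem q

end Kernel

end Summit.Ventures.HSemireg.Wedge.HankelSecant
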